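import Summits.Ventures.PercRepro.C041OneVertexCone

/-!
# ROW C-041 — THE CLASS 𝒵 WITH THE ONE-VERTEX SEED, UP TO STRAY VERTICES: `IsZe` (p6, gen 30; mine-3's C-041.md
§20 (b)(3) with the seed of §19 (j))

`IsZe Z k` — the anchored zones generated from the ONE-VERTEX ZONES (every zone, cycles allowed, whose marks all sit
at one vertex — the marked point `pointZone p q` included) by PENDANT ATTACHMENT at any vertex of any unmarked
multigraph (`C041PendantCone`), by GLUING AT THE ANCHOR (`C041AnchorGlueSix`) and by ZONE EMBEDDINGS IN BOTH
DIRECTIONS (`C041ZoneEmb`: stray isolated unmarked vertices added — `embUp` — or removed — `embDown`; zone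
isomorphisms are the special case).  THE THEOREM: the six-vector of every member lies in mine-3's cone
(`IsZe.inCone`, by induction: the seed by `inCone_sixVec_oneVertex`, the two operations by the landed closure
theorems, the embeddings by `ZoneEmb.sixVec_eq`), hence (P), the one-anchor (CS) and the ZONE O-CUBE
(`IsZe.K4_counts`, `IsZe.zoneCSConj`, `IsZe.zoneOCubeConj`).  The class 𝒵 of `C041ConeClass` is contained in it
(`IsZc.isZe`), and — because `pendant` and `glue` each leave a stray vertex behind — `IsZe` is where the CLEAN zones
live: a one-vertex zone hung on a multigraph is `embDown` of the pendant, a tree is a chain of such steps.  Also: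
embeddings compose (`ZoneEmb.refl`, `ZoneEmb.trans`).
-/

namespace PercRepro

namespace ZoneZ

open ZoneData TreeClosure Pendant AnchorGlue OneVertex Finset

/-! ## Embeddings compose -/

namespace ZoneEmb

variable {V E T₁ T₂ V' E' T₁' T₂' V'' E'' T₁'' T₂'' : Type*} {Z : ZoneData V E T₁ T₂} {Z' : ZoneData V' E' T₁' T₂'}
  {Z'' : ZoneData V'' E'' T₁'' T₂''}

/-- The identity embedding. -/
def refl (Z : ZoneData V E T₁ T₂) : ZoneEmb Z Z :=
  ⟨id, fun _ _ h => h, Equiv.refl E, Equiv.refl T₁, Equiv.refl T₂, fun _ => rfl, fun _ => rfl, fun _ => rfl,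
    fun _ => rfl⟩

/-- Embeddings compose. -/
def trans (φ : ZoneEmb Z Z') (ψ : ZoneEmb Z' Z'') : ZoneEmb Z Z'' where
  v := ψ.v ∘ φ.v
  inj := ψ.inj.comp φ.inj
  e := φ.e.trans ψ.e
  t₁ := φ.t₁.trans ψ.t₁
  t₂ := φ.t₂.trans ψ.t₂
  fst_map := fun x => by rw [Equiv.trans_apply, ψ.fst_map, φ.fst_map]; rfl
  snd_map := fun x => by rw [Equiv.trans_apply, ψ.snd_map, φ.snd_map]; rfl
  at₁_map := fun x => by rw [Equiv.trans_apply, ψ.at₁_map, φ.at₁_map]; rfl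
  at₂_map := fun x => by rw [Equiv.trans_apply, ψ.at₂_map, φ.at₂_map]; rfl

/-- The vertex map of a composite. -/
theorem trans_v (φ : ZoneEmb Z Z') (ψ : ZoneEmb Z' Z'') (u : V) : (φ.trans ψ).v u = ψ.v (φ.v u) := rfl

end ZoneEmb

/-- **THE CLASS 𝒵 WITH THE ONE-VERTEX SEED, UP TO STRAY VERTICES**: anchored zones generated from the zones whose
marks sit at one vertex by pendant attachment, gluing at the anchor, and zone embeddings in both directions. -/
inductive IsZe : {V E T₁ T₂ : Type} → ZoneData V E T₁ T₂ → V → Prop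
  /-- the seed: any zone whose marks all sit at one vertex, at any anchor -/
  | oneVertex {V E T₁ T₂ : Type} (Z : ZoneData V E T₁ T₂) (v₀ : V) (h1 : ∀ i, Z.at₁ i = v₀)
      (h2 : ∀ j, Z.at₂ j = v₀) (k : V) : IsZe Z k
  /-- a member hung at any vertex of any unmarked multigraph, anchored anywhere in the latter -/
  | pendant {V₁ E₁ U₁ U₂ V₂ E₂ T₁ T₂ : Type} (Z₁ : ZoneData V₁ E₁ U₁ U₂) (u a : V₁) (Z₂ : ZoneData V₂ E₂ T₁ T₂)
      (a₂ : V₂) : IsZe Z₂ a₂ → IsZe (Pendant.pendant Z₁ u Z₂ a₂) (Sum.inl a)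
  /-- two members glued at their anchors -/
  | glue {V₂ E₂ S₁ S₂ V₃ E₃ R₁ R₂ : Type} (Z₂ : ZoneData V₂ E₂ S₁ S₂) (a₂ : V₂) (Z₃ : ZoneData V₃ E₃ R₁ R₂)
      (a₃ : V₃) : IsZe Z₂ a₂ → IsZe Z₃ a₃ → IsZe (AnchorGlue.glue Z₂ a₂ Z₃ a₃) (Sum.inl a₂)
  /-- a member with stray vertices added (the target of an embedding) -/
  | embUp {V E T₁ T₂ V' E' T₁' T₂' : Type} {Z : ZoneData V E T₁ T₂} {Z' : ZoneData V' E' T₁' T₂'} (k : V)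
      (φ : ZoneEmb Z Z') : IsZe Z k → IsZe Z' (φ.v k)
  /-- a member with stray vertices removed (the source of an embedding) -/
  | embDown {V E T₁ T₂ V' E' T₁' T₂' : Type} {Z : ZoneData V E T₁ T₂} {Z' : ZoneData V' E' T₁' T₂'} (k : V)
      (φ : ZoneEmb Z Z') : IsZe Z' (φ.v k) → IsZe Z k

/-- An isomorphic copy of a member is a member (zone isomorphisms are embeddings). -/
theorem IsZe.iso {V E T₁ T₂ V' E' T₁' T₂' : Type} {Z : ZoneData V E T₁ T₂} {Z' : ZoneData V' E' T₁' T₂'} (k : V)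
    (φ : ZoneIso Z Z') (h : IsZe Z k) : IsZe Z' (φ.v k) :=
  IsZe.embUp k (ZoneEmb.ofIso φ) h

/-- The class 𝒵 of `C041ConeClass` is contained in the class with the one-vertex seed. -/
theorem IsZc.isZe {V E T₁ T₂ : Type} {Z : ZoneData V E T₁ T₂} {k : V} (h : IsZc Z k) : IsZe Z k := by
  induction h with
  | point p q => exact IsZe.oneVertex _ () (fun _ => rfl) (fun _ => rfl) ()
  | pendant Z₁ u a Z₂ a₂ _ ih => exact IsZe.pendant Z₁ u a Z₂ a₂ ih
  | glue Z₂ a₂ Z₃ a₃ _ _ ih₂ ih₃ => exact IsZe.glue Z₂ a₂ Z₃ a₃ ih₂ ih₃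
  | iso k φ _ ih => exact IsZe.embUp k (ZoneEmb.ofIso φ) ih

/-- **THE SIX-VECTOR OF EVERY MEMBER LIES IN THE CONE**, for every choice of the finiteness instances. -/
theorem IsZe.inCone {V E T₁ T₂ : Type} {Z : ZoneData V E T₁ T₂} {k : V} (h : IsZe Z k) :
    ∀ (iE : Fintype E) (dE : DecidableEq E) (i₁ : Fintype T₁) (d₁ : DecidableEq T₁) (i₂ : Fintype T₂)
      (d₂ : DecidableEq T₂), InCone (@sixVec V E T₁ T₂ Z k iE dE i₁ d₁ i₂ d₂) := by
  induction h with
  | oneVertex Z v₀ h1 h2 k =>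
    intro iE dE i₁ d₁ i₂ d₂
    exact inCone_sixVec_oneVertex Z v₀ h1 h2 k
  | @pendant V₁ E₁ U₁ U₂ V₂ E₂ T₁ T₂ Z₁ u a Z₂ a₂ _ ih =>
    intro iE dE i₁ d₁ i₂ d₂
    haveI : Finite (E₁ ⊕ E₂) := Finite.of_fintype _
    haveI hf₁ : Finite E₁ := Finite.of_injective (Sum.inl : E₁ → E₁ ⊕ E₂) Sum.inl_injective
    haveI hf₂ : Finite E₂ := Finite.of_injective (Sum.inr : E₂ → E₁ ⊕ E₂) Sum.inr_injective
    letI jE₁ : Fintype E₁ := Fintype.ofFinite E₁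
    letI jE₂ : Fintype E₂ := Fintype.ofFinite E₂
    letI eE₁ : DecidableEq E₁ := Classical.decEq E₁
    letI eE₂ : DecidableEq E₂ := Classical.decEq E₂
    cases Subsingleton.elim iE (@instFintypeSum E₁ E₂ jE₁ jE₂)
    cases Subsingleton.elim dE (@instDecidableEqSum E₁ E₂ eE₁ eE₂)
    exact inCone_sixVec_pendant Z₁ u Z₂ a₂ a (ih jE₂ eE₂ i₁ d₁ i₂ d₂)
  | @glue V₂ E₂ S₁ S₂ V₃ E₃ R₁ R₂ Z₂ a₂ Z₃ a₃ _ _ ih₂ ih₃ =>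
    intro iE dE i₁ d₁ i₂ d₂
    haveI : Finite (E₂ ⊕ E₃) := Finite.of_fintype _
    haveI : Finite (S₁ ⊕ R₁) := Finite.of_fintype _
    haveI : Finite (S₂ ⊕ R₂) := Finite.of_fintype _
    haveI : Finite E₂ := Finite.of_injective (Sum.inl : E₂ → E₂ ⊕ E₃) Sum.inl_injective
    haveI : Finite E₃ := Finite.of_injective (Sum.inr : E₃ → E₂ ⊕ E₃) Sum.inr_injective
    haveI : Finite S₁ := Finite.of_injective (Sum.inl : S₁ → S₁ ⊕ R₁) Sum.inl_injective
    haveI : Finite R₁ := Finite.of_injective (Sum.inr : R₁ → S₁ ⊕ R₁) Sum.inr_injective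
    haveI : Finite S₂ := Finite.of_injective (Sum.inl : S₂ → S₂ ⊕ R₂) Sum.inl_injective
    haveI : Finite R₂ := Finite.of_injective (Sum.inr : R₂ → S₂ ⊕ R₂) Sum.inr_injective
    letI jE₂ : Fintype E₂ := Fintype.ofFinite E₂
    letI jE₃ : Fintype E₃ := Fintype.ofFinite E₃
    letI jS₁ : Fintype S₁ := Fintype.ofFinite S₁
    letI jR₁ : Fintype R₁ := Fintype.ofFinite R₁
    letI jS₂ : Fintype S₂ := Fintype.ofFinite S₂
    letI jR₂ : Fintype R₂ := Fintype.ofFinite R₂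
    letI eE₂ : DecidableEq E₂ := Classical.decEq E₂
    letI eE₃ : DecidableEq E₃ := Classical.decEq E₃
    letI eS₁ : DecidableEq S₁ := Classical.decEq S₁
    letI eR₁ : DecidableEq R₁ := Classical.decEq R₁
    letI eS₂ : DecidableEq S₂ := Classical.decEq S₂
    letI eR₂ : DecidableEq R₂ := Classical.decEq R₂
    cases Subsingleton.elim iE (@instFintypeSum E₂ E₃ jE₂ jE₃)
    cases Subsingleton.elim dE (@instDecidableEqSum E₂ E₃ eE₂ eE₃)
    cases Subsingleton.elim i₁ (@instFintypeSum S₁ R₁ jS₁ jR₁)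
    cases Subsingleton.elim d₁ (@instDecidableEqSum S₁ R₁ eS₁ eR₁)
    cases Subsingleton.elim i₂ (@instFintypeSum S₂ R₂ jS₂ jR₂)
    cases Subsingleton.elim d₂ (@instDecidableEqSum S₂ R₂ eS₂ eR₂)
    exact inCone_sixVec_glue Z₂ a₂ Z₃ a₃ (ih₂ jE₂ eE₂ jS₁ eS₁ jS₂ eS₂) (ih₃ jE₃ eE₃ jR₁ eR₁ jR₂ eR₂)
  | @embUp V E T₁ T₂ V' E' T₁' T₂' Z Z' k φ _ ih =>
    intro iE dE i₁ d₁ i₂ d₂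
    haveI : Finite E' := Finite.of_fintype _
    haveI : Finite T₁' := Finite.of_fintype _
    haveI : Finite T₂' := Finite.of_fintype _
    haveI : Finite E := Finite.of_injective φ.e φ.e.injective
    haveI : Finite T₁ := Finite.of_injective φ.t₁ φ.t₁.injective
    haveI : Finite T₂ := Finite.of_injective φ.t₂ φ.t₂.injective
    letI jE : Fintype E := Fintype.ofFinite E
    letI j₁ : Fintype T₁ := Fintype.ofFinite T₁
    letI j₂ : Fintype T₂ := Fintype.ofFinite T₂
    letI eE : DecidableEq E := Classical.decEq E
    letI e₁ : DecidableEq T₁ := Classical.decEq T₁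
    letI e₂ : DecidableEq T₂ := Classical.decEq T₂
    rw [ZoneEmb.sixVec_eq φ k]
    exact ih jE eE j₁ e₁ j₂ e₂
  | @embDown V E T₁ T₂ V' E' T₁' T₂' Z Z' k φ _ ih =>
    intro iE dE i₁ d₁ i₂ d₂
    haveI : Finite E := Finite.of_fintype _
    haveI : Finite T₁ := Finite.of_fintype _
    haveI : Finite T₂ := Finite.of_fintype _
    haveI : Finite E' := Finite.of_injective φ.e.symm φ.e.symm.injective
    haveI : Finite T₁' := Finite.of_injective φ.t₁.symm φ.t₁.symm.injective
    haveI : Finite T₂' := Finite.of_injective φ.t₂.symm φ.t₂.symm.injective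
    letI jE : Fintype E' := Fintype.ofFinite E'
    letI j₁ : Fintype T₁' := Fintype.ofFinite T₁'
    letI j₂ : Fintype T₂' := Fintype.ofFinite T₂'
    letI eE : DecidableEq E' := Classical.decEq E'
    letI e₁ : DecidableEq T₁' := Classical.decEq T₁'
    letI e₂ : DecidableEq T₂' := Classical.decEq T₂'
    rw [← ZoneEmb.sixVec_eq φ k]
    exact ih jE eE j₁ e₁ j₂ e₂

/-- **THE INVARIANT (P) ON THE CLASS.** -/
theorem IsZe.K4_counts {V E T₁ T₂ : Type} {Z : ZoneData V E T₁ T₂} {k : V} (h : IsZe Z k) [Fintype E]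
    [DecidableEq E] [Fintype T₁] [DecidableEq T₁] [Fintype T₂] [DecidableEq T₂] :
    K4 (#(Z.Fset k) : ℝ) (#(Z.T1set k)) (#(Z.T2set k)) (#(Z.Iset k)) :=
  Z.K4_of_inCone_sixVec k (h.inCone _ _ _ _ _ _)

/-- **THE ONE-ANCHOR (CS) ON THE CLASS.** -/
theorem IsZe.zoneCSConj {V E T₁ T₂ : Type} {Z : ZoneData V E T₁ T₂} {k : V} (h : IsZe Z k) [Fintype E]
    [DecidableEq E] [Fintype T₁] [DecidableEq T₁] [Fintype T₂] [DecidableEq T₂] :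
    Z.ZoneCSConj {k} (∅ : Set V) :=
  Z.zoneCSConj_of_inCone_sixVec k (h.inCone _ _ _ _ _ _)

/-- **THE ZONE O-CUBE ON THE CLASS** — mine-3's CONJECTURE (ZONE O-CUBE) is a theorem on every zone generated from
the one-vertex zones by hanging at vertices of unmarked multigraphs, gluing at the anchor, and adding or removing
stray vertices. -/
theorem IsZe.zoneOCubeConj {V E T₁ T₂ : Type} {Z : ZoneData V E T₁ T₂} {k : V} (h : IsZe Z k) [Fintype E]
    [DecidableEq E] [Fintype T₁] [DecidableEq T₁] [Fintype T₂] [DecidableEq T₂] :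
    Z.ZoneOCubeConj {k} (∅ : Set V) :=
  Z.zoneOCubeConj_of_inCone_sixVec k (h.inCone _ _ _ _ _ _)

/-- A one-vertex zone hung at a vertex of an unmarked multigraph, WITHOUT the stray vertex: every zone that embeds
into such a pendant (the anchor in the multigraph) is a member. -/
theorem IsZe.of_emb_pendant_oneVertex {V E T₁ T₂ V₁ E₁ U₁ U₂ V₂ E₂ : Type} {Z : ZoneData V E T₁ T₂}
    (Z₁ : ZoneData V₁ E₁ U₁ U₂) (u a : V₁) (Z₂ : ZoneData V₂ E₂ T₁ T₂) (a₂ v₀ : V₂)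
    (h1 : ∀ i, Z₂.at₁ i = v₀) (h2 : ∀ j, Z₂.at₂ j = v₀) (φ : ZoneEmb Z (Pendant.pendant Z₁ u Z₂ a₂)) (k : V)
    (hk : φ.v k = Sum.inl a) : IsZe Z k := by
  refine IsZe.embDown k φ ?_
  rw [hk]
  exact IsZe.pendant Z₁ u a Z₂ a₂ (IsZe.oneVertex Z₂ v₀ h1 h2 a₂)

end ZoneZ

end PercRepro
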